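import Mathlib
import Summits.Ventures.PercRepro2.RootPairSep

/-!
# Two-terminal pieces are edges
(blind cell PercRepro2, mine-2 g21; proofs/MINE2-CUTU.md Lemma 11.4 in full: an unmarked piece
attached at two vertices is one edge whose weight is the piece's internal connection probability;
the series and parallel cases are `SeriesReduction.lean`, `ParallelReduction.lean`).

Let `{x, y}` separate `V₁` from `V₂` (`IsRootPairSep ends x y V₁ V₂`: both in both sides, nothing
else in both, every edge inside one side) and let `e₀` be an edge of the piece (a side-2 edge).
Write `B = {x ↔ y inside V₂}` and `π = P(B)`.  The reduced graph keeps the edges of `V₁`, turns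
`e₀` into the edge `{x, y}` and every other side-2 edge into a loop at `x`; it carries the weight
`π` on `e₀`.  For `u, v ∈ V₁` the connections agree (`conn_two_terminal`: the side-2 edges act only
through `B`), and for every event of the connectivity relation that only looks at `V₁` the
probability is unchanged (`prob_two_terminal`; independence of the two sides, `prob_openEdge`,
and the pin identity to replace the weight of `e₀`).
-/

namespace Summit.Ventures.PercRepro2

namespace RootPairSep

open SepPair

section Graph

variable {V : Type*} {E : Type*} {ends : E → Sym2 V} {x y : V} {V₁ V₂ : Set V}
  [DecidablePred (· ∈ side₁ ends V₁)] [DecidablePred (· ∈ (side₁ ends V₁)ᶜ)] {e₀ : E}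

/-- **Two-terminal piece.**  For `u, v ∈ V₁` and `b` recording `{x ↔ y inside V₂}`, `u ↔ v` in `G`
iff `u ↔ v` in the reduced graph under the configuration `ω` restricted to `V₁` with `e₀ := b`. -/
lemma conn_two_terminal [DecidableEq E] (hs : IsRootPairSep ends x y V₁ V₂)
    (he₀ : e₀ ∉ side₁ ends V₁) {ω : Config E} {b : Bool}
    (hb : b = true ↔ Conn ends (restrictTo (side₁ ends V₁)ᶜ ω) x y) {u v : V}
    (hu : u ∈ V₁) (hv : v ∈ V₁) :
    Conn ends ω u v ↔
      Conn (fun e => if e ∈ side₁ ends V₁ then ends e else if e = e₀ then s(x, y) else s(x, x))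
        (Function.update (restrictTo (side₁ ends V₁) ω) e₀ b) u v := by
  set ends' : E → Sym2 V :=
    fun e => if e ∈ side₁ ends V₁ then ends e else if e = e₀ then s(x, y) else s(x, x) with hends'
  set ω' := Function.update (restrictTo (side₁ ends V₁) ω) e₀ b with hω'
  have hx₁ : x ∈ V₁ := hs.a₁_mem.1
  have hy₁ : y ∈ V₁ := hs.a₂_mem.1
  have hxy : ∀ z, z ∈ V₁ → z ∈ V₂ → z = x ∨ z = y := by
    intro z h₁ h₂
    have := hs.inter_sub ⟨h₁, h₂⟩
    simpa using this
  -- edges of `V₁` are unchanged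
  have hend₁ : ∀ e, e ∈ side₁ ends V₁ → ends' e = ends e := fun e he => by
    simp only [hends', he, if_true]
  have hω'₁ : ∀ e, e ∈ side₁ ends V₁ → ω' e = ω e := fun e he => by
    have hne : e ≠ e₀ := fun h => he₀ (h ▸ he)
    rw [hω', Function.update_of_ne hne, restrictTo_apply_of_mem he]
  have hend₀ : ends' e₀ = s(x, y) := by simp only [hends', he₀, if_false, if_true]
  have hω'₀ : ω' e₀ = b := by rw [hω', Function.update_self]
  have hω'₂ : ∀ e, e ∉ side₁ ends V₁ → e ≠ e₀ → ω' e = false := fun e he hne => by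
    rw [hω', Function.update_of_ne hne, restrictTo_apply_of_notMem he]
  -- `x ↔ y` in the reduced graph when `b = true`
  have hxy' : b = true → Conn ends' ω' x y := fun hbt =>
    conn_of_openAdj ⟨e₀, hω'₀.trans hbt, hend₀⟩
  constructor
  · intro h
    let S : Set V := {z | (z ∈ V₁ ∧ Conn ends' ω' u z) ∨
      (z ∉ V₁ ∧ ((Conn ends' ω' u x ∧ Conn ends (restrictTo (side₁ ends V₁)ᶜ ω) x z) ∨
        (Conn ends' ω' u y ∧ Conn ends (restrictTo (side₁ ends V₁)ᶜ ω) y z)))}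
    have huS : u ∈ S := Or.inl ⟨hu, conn_refl _ _ _⟩
    have hclosed : ∀ e z z', ω e = true → ends e = s(z, z') → z ∈ S → z' ∈ S := by
      intro e z z' he hends hzS
      by_cases heF : e ∈ side₁ ends V₁
      · -- an edge of `V₁`
        have hz'₁ : z' ∈ V₁ := (heF z z' hends).2
        rcases hzS with ⟨_, hc⟩ | ⟨hz, _⟩
        · have he' : ω' e = true := by rw [hω'₁ e heF]; exact he
          have hends'' : ends' e = s(z, z') := by rw [hend₁ e heF]; exact hends
          exact Or.inl ⟨hz'₁, conn_trans hc (conn_of_openAdj ⟨e, he', hends''⟩)⟩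
        · exact absurd (heF z z' hends).1 hz
      · -- an edge of the piece: it is open in the restriction to side 2
        have he₂ : restrictTo (side₁ ends V₁)ᶜ ω e = true :=
          restrictTo_eq_true_of_mem (show e ∈ (side₁ ends V₁)ᶜ from heF) he
        have hadj : Conn ends (restrictTo (side₁ ends V₁)ᶜ ω) z z' := conn_of_openAdj ⟨e, he₂, hends⟩
        have hz₂ : z ∈ V₂ := (mem_side₂_of_not_side₁ hs hends heF).1
        have hz'₂ : z' ∈ V₂ := (mem_side₂_of_not_side₁ hs hends heF).2
        -- the starting point `z` is `x`, `y` or an interior vertex; record a route to `z'`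
        have hroute : (Conn ends' ω' u x ∧ Conn ends (restrictTo (side₁ ends V₁)ᶜ ω) x z') ∨
            (Conn ends' ω' u y ∧ Conn ends (restrictTo (side₁ ends V₁)ᶜ ω) y z') := by
          rcases hzS with ⟨hz₁, hc⟩ | ⟨_, ⟨hcx, hx'⟩ | ⟨hcy, hy'⟩⟩
          · rcases hxy z hz₁ hz₂ with rfl | rfl
            · exact Or.inl ⟨hc, hadj⟩
            · exact Or.inr ⟨hc, hadj⟩
          · exact Or.inl ⟨hcx, conn_trans hx' hadj⟩
          · exact Or.inr ⟨hcy, conn_trans hy' hadj⟩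
        by_cases hz'₁ : z' ∈ V₁
        · -- `z'` is `x` or `y`
          rcases hxy z' hz'₁ hz'₂ with rfl | rfl
          · rcases hroute with ⟨hcx, _⟩ | ⟨hcy, hyx⟩
            · exact Or.inl ⟨hz'₁, hcx⟩
            · have hB : b = true := hb.2 (conn_symm hyx)
              exact Or.inl ⟨hz'₁, conn_trans hcy (conn_symm (hxy' hB))⟩
          · rcases hroute with ⟨hcx, hxy₂⟩ | ⟨hcy, _⟩
            · have hB : b = true := hb.2 hxy₂
              exact Or.inl ⟨hz'₁, conn_trans hcx (hxy' hB)⟩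
            · exact Or.inl ⟨hz'₁, hcy⟩
        · exact Or.inr ⟨hz'₁, hroute⟩
    have hvS : v ∈ S := mem_of_conn_of_closed' hclosed huS h
    rcases hvS with ⟨_, hc⟩ | ⟨hv', _⟩
    · exact hc
    · exact absurd hv hv'
  · intro h
    let S : Set V := {z | Conn ends ω u z}
    have huS : u ∈ S := conn_refl _ _ _
    have hclosed : ∀ e z z', ω' e = true → ends' e = s(z, z') → z ∈ S → z' ∈ S := by
      intro e z z' he hends hzS
      by_cases heF : e ∈ side₁ ends V₁
      · have he' : ω e = true := by rw [hω'₁ e heF] at he; exact he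
        have hends₀ : ends e = s(z, z') := by rw [hend₁ e heF] at hends; exact hends
        exact conn_trans hzS (conn_of_openAdj ⟨e, he', hends₀⟩)
      · by_cases hne : e = e₀
        · subst hne
          rw [hω'₀] at he
          have hB : Conn ends (restrictTo (side₁ ends V₁)ᶜ ω) x y := hb.1 he
          have hxyG : Conn ends ω x y := conn_of_conn_restrictTo hB
          rw [hend₀] at hends
          rcases Sym2.eq_iff.1 hends.symm with ⟨rfl, rfl⟩ | ⟨rfl, rfl⟩
          · exact conn_trans hzS hxyG
          · exact conn_trans hzS (conn_symm hxyG)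
        · rw [hω'₂ e heF hne] at he
          exact absurd he Bool.false_ne_true
    exact mem_of_conn_of_closed' hclosed huS h

omit [DecidablePred (· ∈ (side₁ ends V₁)ᶜ)] in
/-- In the reduced graph the loops are irrelevant: only the edges of `V₁` and `e₀` matter. -/
lemma conn_reduced_eq [DecidableEq E] (he₀ : e₀ ∉ side₁ ends V₁) (ω : Config E) (u v : V) :
    Conn (fun e => if e ∈ side₁ ends V₁ then ends e else if e = e₀ then s(x, y) else s(x, x)) ω u v ↔
      Conn (fun e => if e ∈ side₁ ends V₁ then ends e else if e = e₀ then s(x, y) else s(x, x))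
        (Function.update (restrictTo (side₁ ends V₁) ω) e₀ (ω e₀)) u v := by
  set ends' : E → Sym2 V :=
    fun e => if e ∈ side₁ ends V₁ then ends e else if e = e₀ then s(x, y) else s(x, x) with hends'
  set ω' := Function.update (restrictTo (side₁ ends V₁) ω) e₀ (ω e₀) with hω'
  have hω'₁ : ∀ e, e ∈ side₁ ends V₁ → ω' e = ω e := fun e he => by
    have hne : e ≠ e₀ := fun h => he₀ (h ▸ he)
    rw [hω', Function.update_of_ne hne, restrictTo_apply_of_mem he]
  have hω'₀ : ω' e₀ = ω e₀ := by rw [hω', Function.update_self]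
  have hω'₂ : ∀ e, e ∉ side₁ ends V₁ → e ≠ e₀ → ω' e = false := fun e he hne => by
    rw [hω', Function.update_of_ne hne, restrictTo_apply_of_notMem he]
  have hloop : ∀ e, e ∉ side₁ ends V₁ → e ≠ e₀ → ends' e = s(x, x) := fun e he hne => by
    simp only [hends', he, hne, if_false]
  constructor
  · intro h
    let S : Set V := {z | Conn ends' ω' u z}
    have hclosed : ∀ e z z', ω e = true → ends' e = s(z, z') → z ∈ S → z' ∈ S := by
      intro e z z' he hends hzS
      by_cases heF : e ∈ side₁ ends V₁
      · have he' : ω' e = true := by rw [hω'₁ e heF]; exact he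
        exact conn_trans hzS (conn_of_openAdj ⟨e, he', hends⟩)
      · by_cases hne : e = e₀
        · have he' : ω' e = true := by rw [hne, hω'₀, ← hne]; exact he
          exact conn_trans hzS (conn_of_openAdj ⟨e, he', hends⟩)
        · rw [hloop e heF hne] at hends
          rcases Sym2.eq_iff.1 hends.symm with ⟨rfl, rfl⟩ | ⟨rfl, rfl⟩ <;> exact hzS
    exact mem_of_conn_of_closed' hclosed (conn_refl _ _ _) h
  · intro h
    let S : Set V := {z | Conn ends' ω u z}
    have hclosed : ∀ e z z', ω' e = true → ends' e = s(z, z') → z ∈ S → z' ∈ S := by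
      intro e z z' he hends hzS
      by_cases heF : e ∈ side₁ ends V₁
      · have he' : ω e = true := by rw [hω'₁ e heF] at he; exact he
        exact conn_trans hzS (conn_of_openAdj ⟨e, he', hends⟩)
      · by_cases hne : e = e₀
        · have he' : ω e = true := by rw [hne, hω'₀] at he; rw [hne]; exact he
          exact conn_trans hzS (conn_of_openAdj ⟨e, he', hends⟩)
        · rw [hω'₂ e heF hne] at he
          exact absurd he Bool.false_ne_true
    exact mem_of_conn_of_closed' hclosed (conn_refl _ _ _) h

end Graph

section Prob

variable {V : Type*} {E : Type*} [Fintype E] [DecidableEq E] {R : Type*} [CommRing R]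
  {ends : E → Sym2 V} {x y : V} {V₁ V₂ : Set V}
  [DecidablePred (· ∈ side₁ ends V₁)] [DecidablePred (· ∈ (side₁ ends V₁)ᶜ)] {e₀ : E}

omit [DecidablePred (· ∈ side₁ ends V₁)] [DecidablePred (· ∈ (side₁ ends V₁)ᶜ)] in
/-- Changing the weight of an edge the event does not depend on changes nothing. -/
lemma prob_update_of_dependsOn (p : E → R) {A : Set (Config E)} {F : Set E}
    (hA : DependsOn (fun ω => ω ∈ A) F) {e : E} (he : e ∉ F) (c : R) :
    prob (Function.update p e c) A = prob p A := by
  have h1 : ∀ q : E → R, prob (Function.update q e 1) A = prob q A := by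
    intro q
    rw [prob_eq_expect_indicator, prob_eq_expect_indicator, expect_update_one]
    congr 1
    funext ω
    have : Function.update ω e true ∈ A ↔ ω ∈ A :=
      dependsOn_mem_iff hA (fun i hi => Function.update_of_ne (fun h => he (by rw [← h]; exact hi)) _ _)
    by_cases hω : ω ∈ A
    · rw [Set.indicator_of_mem hω, Set.indicator_of_mem (this.2 hω)]; rfl
    · rw [Set.indicator_of_notMem hω, Set.indicator_of_notMem (fun hh => hω (this.1 hh))]
  have h0 : ∀ q : E → R, prob (Function.update q e 0) A = prob q A := by
    intro q
    rw [prob_eq_expect_indicator, prob_eq_expect_indicator, expect_update_zero]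
    congr 1
    funext ω
    have : Function.update ω e false ∈ A ↔ ω ∈ A :=
      dependsOn_mem_iff hA (fun i hi => Function.update_of_ne (fun h => he (by rw [← h]; exact hi)) _ _)
    by_cases hω : ω ∈ A
    · rw [Set.indicator_of_mem hω, Set.indicator_of_mem (this.2 hω)]; rfl
    · rw [Set.indicator_of_notMem hω, Set.indicator_of_notMem (fun hh => hω (this.1 hh))]
  have hq := prob_eq_pin (Function.update p e c) A e
  rw [Function.update_self, Function.update_idem, Function.update_idem, h1, h0] at hq
  have hp := prob_eq_pin p A e
  rw [h1, h0] at hp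
  linear_combination hq - hp

/-- **Two-terminal pieces are edges.**  For every event of the connectivity relation that only
looks at `V₁`, the probability under `p` equals the probability in the reduced graph with the
weight `π = P(x ↔ y inside V₂)` on `e₀`. -/
theorem prob_two_terminal (hs : IsRootPairSep ends x y V₁ V₂) (he₀ : e₀ ∉ side₁ ends V₁)
    (p : E → R) (P : (V → V → Prop) → Prop)
    (hP : ∀ r r' : V → V → Prop, (∀ u v, u ∈ V₁ → v ∈ V₁ → (r u v ↔ r' u v)) → (P r ↔ P r')) :
    prob p {ω | P (Conn ends ω)} =
      prob (Function.update p e₀ (prob p (restrictTo (side₁ ends V₁)ᶜ ⁻¹' connEvent ends x y)))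
        {ω | P (Conn (fun e => if e ∈ side₁ ends V₁ then ends e else if e = e₀ then s(x, y)
          else s(x, x)) ω)} := by
  set ends' : E → Sym2 V :=
    fun e => if e ∈ side₁ ends V₁ then ends e else if e = e₀ then s(x, y) else s(x, x) with hends'
  set B := restrictTo (side₁ ends V₁)ᶜ ⁻¹' connEvent ends x y with hB
  set π := prob p B with hπ
  set Ψ : Bool → Set (Config E) := fun b =>
    restrictTo (side₁ ends V₁) ⁻¹' {σ | P (Conn ends' (Function.update σ e₀ b))} with hΨ
  have hΨdep : ∀ b, DependsOn (fun ω => ω ∈ Ψ b) (side₁ ends V₁) := fun b =>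
    dependsOn_restrictTo _ _
  have hBdep : DependsOn (fun ω => ω ∈ B) (side₁ ends V₁)ᶜ := dependsOn_restrictTo _ _
  have hBdep' : DependsOn (fun ω => ω ∈ Bᶜ) (side₁ ends V₁)ᶜ := dependsOn_compl hBdep
  -- the left side: `X = (Ψ true ∩ B) ∪ (Ψ false ∩ Bᶜ)`
  have eX : {ω | P (Conn ends ω)} = (Ψ true ∩ B) ∪ (Ψ false ∩ Bᶜ) := by
    ext ω
    simp only [Set.mem_setOf_eq, Set.mem_union, Set.mem_inter_iff, Set.mem_compl_iff, hΨ,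
      Set.mem_preimage]
    by_cases hω : ω ∈ B
    · have hconn : Conn ends (restrictTo (side₁ ends V₁)ᶜ ω) x y := hω
      have key := hP (Conn ends ω)
        (Conn ends' (Function.update (restrictTo (side₁ ends V₁) ω) e₀ true))
        (fun u v hu hv => conn_two_terminal hs he₀ (b := true) ⟨fun _ => hconn, fun _ => rfl⟩ hu hv)
      constructor
      · intro h; exact Or.inl ⟨key.1 h, hω⟩
      · rintro (⟨h, _⟩ | ⟨_, h'⟩)
        · exact key.2 h
        · exact absurd hω h'
    · have hconn : ¬ Conn ends (restrictTo (side₁ ends V₁)ᶜ ω) x y := hω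
      have key := hP (Conn ends ω)
        (Conn ends' (Function.update (restrictTo (side₁ ends V₁) ω) e₀ false))
        (fun u v hu hv => conn_two_terminal hs he₀ (b := false)
          ⟨fun h => absurd h Bool.false_ne_true, fun h => absurd h hconn⟩ hu hv)
      constructor
      · intro h; exact Or.inr ⟨key.1 h, hω⟩
      · rintro (⟨_, h'⟩ | ⟨h, _⟩)
        · exact absurd h' hω
        · exact key.2 h
  have hdisj : Disjoint (Ψ true ∩ B) (Ψ false ∩ Bᶜ) := by
    rw [Set.disjoint_left]
    rintro ω ⟨_, h₁⟩ ⟨_, h₂⟩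
    exact h₂ h₁
  have LHS : prob p {ω | P (Conn ends ω)} = prob p (Ψ true) * π + prob p (Ψ false) * (1 - π) := by
    rw [eX, prob_union_of_disjoint p hdisj,
      prob_inter_eq_mul_of_dependsOn_compl p (side₁ ends V₁) (hΨdep true) hBdep,
      prob_inter_eq_mul_of_dependsOn_compl p (side₁ ends V₁) (hΨdep false) hBdep', prob_compl]
  -- the right side: `X' = (Ψ true ∩ O) ∪ (Ψ false ∩ Oᶜ)`
  have eX' : {ω | P (Conn ends' ω)} = (Ψ true ∩ openEdge e₀) ∪ (Ψ false ∩ (openEdge e₀)ᶜ) := by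
    ext ω
    simp only [Set.mem_setOf_eq, Set.mem_union, Set.mem_inter_iff, Set.mem_compl_iff, hΨ,
      Set.mem_preimage]
    have key := hP (Conn ends' ω)
      (Conn ends' (Function.update (restrictTo (side₁ ends V₁) ω) e₀ (ω e₀)))
      (fun u v _ _ => conn_reduced_eq he₀ ω u v)
    by_cases hω : ω ∈ openEdge e₀
    · have ho : ω e₀ = true := hω
      rw [ho] at key
      constructor
      · intro h; exact Or.inl ⟨key.1 h, hω⟩
      · rintro (⟨h, _⟩ | ⟨_, h'⟩)
        · exact key.2 h
        · exact absurd hω h'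
    · have ho : ω e₀ = false := by
        have : ¬ ω e₀ = true := hω
        simpa using this
      rw [ho] at key
      constructor
      · intro h; exact Or.inr ⟨key.1 h, hω⟩
      · rintro (⟨_, h'⟩ | ⟨h, _⟩)
        · exact absurd h' hω
        · exact key.2 h
  have hdisj' : Disjoint (Ψ true ∩ openEdge e₀) (Ψ false ∩ (openEdge e₀)ᶜ) := by
    rw [Set.disjoint_left]
    rintro ω ⟨_, h₁⟩ ⟨_, h₂⟩
    exact h₂ h₁
  have hOdep : DependsOn (fun ω => ω ∈ openEdge e₀) (side₁ ends V₁)ᶜ := fun ω ω' h =>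
    dependsOn_openEdge e₀ (fun i hi => h i (by
      rw [Set.mem_singleton_iff] at hi
      rw [hi]; exact he₀))
  have hOdep' : DependsOn (fun ω => ω ∈ (openEdge e₀)ᶜ) (side₁ ends V₁)ᶜ := dependsOn_compl hOdep
  have hπ' : prob (Function.update p e₀ π) (openEdge e₀) = π := by
    rw [prob_openEdge, Function.update_self]
  have hΨ' : ∀ b, prob (Function.update p e₀ π) (Ψ b) = prob p (Ψ b) := fun b =>
    prob_update_of_dependsOn p (hΨdep b) he₀ π
  have RHS : prob (Function.update p e₀ π) {ω | P (Conn ends' ω)} =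
      prob p (Ψ true) * π + prob p (Ψ false) * (1 - π) := by
    rw [eX', prob_union_of_disjoint _ hdisj',
      prob_inter_eq_mul_of_dependsOn_compl _ (side₁ ends V₁) (hΨdep true) hOdep,
      prob_inter_eq_mul_of_dependsOn_compl _ (side₁ ends V₁) (hΨdep false) hOdep', prob_compl,
      hπ', hΨ', hΨ']
  rw [LHS, RHS]

/-- Example use: a single connection event between vertices of `V₁`. -/
theorem prob_connEvent_two_terminal (hs : IsRootPairSep ends x y V₁ V₂) (he₀ : e₀ ∉ side₁ ends V₁)
    (p : E → R) {u v : V} (hu : u ∈ V₁) (hv : v ∈ V₁) :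
    prob p (connEvent ends u v) =
      prob (Function.update p e₀ (prob p (restrictTo (side₁ ends V₁)ᶜ ⁻¹' connEvent ends x y)))
        (connEvent (fun e => if e ∈ side₁ ends V₁ then ends e else if e = e₀ then s(x, y)
          else s(x, x)) u v) :=
  prob_two_terminal hs he₀ p (fun r => r u v) (fun _ _ h => h u v hu hv)

/-- Example use: a connection event intersected with a non-connection, both inside `V₁`. -/
theorem prob_connEvent_inter_compl_two_terminal (hs : IsRootPairSep ends x y V₁ V₂)
    (he₀ : e₀ ∉ side₁ ends V₁) (p : E → R) {u v a b : V} (hu : u ∈ V₁) (hv : v ∈ V₁)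
    (ha : a ∈ V₁) (hb : b ∈ V₁) :
    prob p (connEvent ends u v ∩ (connEvent ends a b)ᶜ) =
      prob (Function.update p e₀ (prob p (restrictTo (side₁ ends V₁)ᶜ ⁻¹' connEvent ends x y)))
        (connEvent (fun e => if e ∈ side₁ ends V₁ then ends e else if e = e₀ then s(x, y)
          else s(x, x)) u v ∩
          (connEvent (fun e => if e ∈ side₁ ends V₁ then ends e else if e = e₀ then s(x, y)
            else s(x, x)) a b)ᶜ) :=
  prob_two_terminal hs he₀ p (fun r => r u v ∧ ¬ r a b)
    (fun _ _ h => by rw [h u v hu hv, h a b ha hb])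

end Prob

end RootPairSep

end Summit.Ventures.PercRepro2
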